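import Literature.MathematicalPhysics.QuantumFieldTheory.Balaban1983to89.B4Thm19BoxHolderUniform
import Literature.MathematicalPhysics.QuantumFieldTheory.Balaban1983to89.B4Thm110BoxNoCollar
import Literature.MathematicalPhysics.QuantumFieldTheory.Balaban1983to89.B4Lemma22HolderNoCollar

/-!
# `Balaban1983to89.B4Thm19BoxNoCollar` — [Balaban1983RegularityDecay] THEOREM p. 573, (1.9) THE HÖLDER MEMBER (close
# pairs) ON A BOX, FOR EVERY (1.7)-REGULAR FIELD — **NO COLLAR HYPOTHESIS**, the large-cube modulus `K` chosen before `α`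

statement-level skeleton of published theorems with citation tags; proofs where landed; nothing here is a claim about the Yang–Mills mass gap

CITATION HEADER.  T. Bałaban, *Regularity and decay of lattice Green's functions*, Commun. Math. Phys. **89** (1983)
571–597, doi:10.1007/bf01214744 [Balaban1983RegularityDecay] (cell paper B4; held text
`paper:balaban1983-cmp89-regularity-decay`, journal page = PDF page + 570; pp. 572–573, 575–579, 581).  Unit
`lit-balaban-r04` gen 15 (B4 second reader; HOME `run/shared/lean/pub/lit-balaban/`), SKELETON row **B4.Thm@573**
((1.9), rectangular `Ω`); HOME/GAPS.md **G-B4-p17-02** — step (4) of the collar-drop programme, Hölder member.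
Imports p17 g5 `B4Thm19BoxHolderUniform` (→ `B4Thm19BoxHolderCut.thm19_holder_boxCut`, the walk route with the
print's cut cubes for (1.9); `B4Thm19BoxHolderAll.rpow_le_max_one`/`abs_U_mulVec_apply_le`),
r04 g15 `B4Thm110BoxNoCollar` (`subField_compField`; → `B4Thm110BoxUniform.regular_shift`) and r04 g15
`B4Lemma22HolderNoCollar` (`lemma22_holder_noCollar`; → `B4Lemma22BoxNoCollar.lemma22_sup_noCollar`/`eq220_noCollar`).

WHAT IS PRINTED.  p. 573 (1.9) «For α < 1 there exist positive constants δ₀, c₀, R₀ independent of A, k, Ω … such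
that for e sufficiently small … |x − x′|^{−α}|U(A(Γ_{x,x′}))(D^η_{A,μ}G_k(Ω,A)f)(x′) − (D^η_{A,μ}G_k(Ω,A)f)(x)| ≤
c₀exp(−δ₀dist({x,x′}, supp f))‖f‖_∞ … for rectangular parallelepipeds, the inequalities hold without any restrictions
on the points»; p. 579 «if Ω is a rectangular parallelepiped, then all □_j … are cubes and we can apply Lemma 2.2 to
all operators in it».

WHAT THIS MODULE PROVES (in full; `Ω = Box d ℓ k Mb`, `d ≥ 1`).  **`thm19_holder_box_noCollar`** — (1.9) for close
pairs (`32|x′−x|_∞ ≤ nK`) on a box: `∃ K` (`16 ≤ K`, `4 ∣ K`) `∀ α ∈ [0,1)` `∃ c₁ > 0` `∀ (c, β)` `∃ e₁ > 0` —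
BEFORE the box —, for every `k ≥ 1`, `(a, m²)` in the window, EVERY box with `K ∣ Mb_μ`, EVERY (1.7)-regular
component field `A` on `Ω` (NO condition at `∂Ω`), `0 < e ≤ e₁`, direction `μ`, fine sites `x ≠ x′` with
`x+e_μ, x′+e_μ ∈ Ω`, a nearest-neighbour chain `Γ` from `x` to `x′` of length `≤ (d+1)|x′−x|_∞` inside the
`|x′−x|_∞`-ball about `x`, every `f` supported at unit-lattice sup-distance `≥ D` from `x` with `|f| ≤ φ`:
`(n/|x′−x|_∞)^α·|U(A(Γ))(D^η_{A,μ}G_k(Ω,A)f)(x′) − (D^η_{A,μ}G_k(Ω,A)f)(x)|_i ≤ c₁·e^{−D/K}·φ` — p17's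
`B4Thm19BoxHolderUniform.thm19_holder_box_uniform_unifK` with the collar clause DROPPED (per-cube inputs at
`Ã_j := A` on every cut cube from `B4Lemma22BoxNoCollar`/`B4Lemma22HolderNoCollar`); **`thm19_holder_box_noCollar_all`**
— all pairs `x ≠ x′` (far pairs by the derivative member `B4Thm110BoxNoCollar.thm110_deriv_box_noCollar` at `x` and
`x′`, as in p17's `thm19_holder_box_uniform_all_unifK`), no collar.
HONEST SCOPE.  (i) `d ≥ 1`, `0 ≤ α < 1`; (ii) the lineage's (1.6);
(iii) `δ₀ = 1/K`; `c₁`, `K` depend on `(d, N, ℓ₁, L, a₋, a₊, m²₊)` (`c₁` also on `α`), `e₁` on these and `(c, β)` ONLY.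
Theorems only; no `def`, no `Prop` fact, no `sorry`; axioms standard.
-/

namespace Literature.MathematicalPhysics.QuantumFieldTheory.Balaban1983to89.B4Thm19BoxNoCollar

open Literature.MathematicalPhysics.QuantumFieldTheory.Balaban1983to89.B4Reflection242 (boxDom mem_boxDom nbrs mem_nbrs)
open Literature.MathematicalPhysics.QuantumFieldTheory.Balaban1983to89.B4GaugeCovariance
open Literature.MathematicalPhysics.QuantumFieldTheory.Balaban1983to89.B4Commutators25to211 (mulH)
open Literature.MathematicalPhysics.QuantumFieldTheory.Balaban1983to89.B4Lower18Regular (e1 baseEmb stairContour)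
open Literature.MathematicalPhysics.QuantumFieldTheory.Balaban1983to89.B4Lower18RegularRegion (compField)
open Literature.MathematicalPhysics.QuantumFieldTheory.Balaban1983to89.B4Lemma21Region (siteNorm)
open Literature.MathematicalPhysics.QuantumFieldTheory.Balaban1983to89.B4ContourShift (supNorm)
open Literature.MathematicalPhysics.QuantumFieldTheory.Balaban1983to89.B4Lemma22ReduceZero (Box opA greenA derivA)
open Literature.MathematicalPhysics.QuantumFieldTheory.Balaban1983to89.B4Lemma22Reduce231 (supN supN_nonneg)
open Literature.MathematicalPhysics.QuantumFieldTheory.Balaban1983to89.B4Eq220PartitionSizes (hBox)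
open Literature.MathematicalPhysics.QuantumFieldTheory.Balaban1983to89.B4Eq220CommutatorField (kOp)
open Literature.MathematicalPhysics.QuantumFieldTheory.Balaban1983to89.B4PartitionUnity22 (hprof D1 D2 D1_nonneg
  D2_nonneg contDiff_hprof hasCompactSupport_hprof)
open Literature.MathematicalPhysics.QuantumFieldTheory.Balaban1983to89.B4Lemma22HolderBox (IsNNChain
  transport_fieldLink)
open Literature.MathematicalPhysics.QuantumFieldTheory.Balaban1983to89.B4HolderChainTools (one_le_supNorm_of_ne)
open Literature.MathematicalPhysics.QuantumFieldTheory.Balaban1983to89.B4Thm19BoxHolderAll (rpow_le_max_one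
  abs_U_mulVec_apply_le)
open Literature.MathematicalPhysics.QuantumFieldTheory.Balaban1983to89.B4CubeGreenBox (subField)
open Literature.MathematicalPhysics.QuantumFieldTheory.Balaban1983to89.B4BoxCubeGeometry (posR cubeLo cubeMs cube_ho)
open Literature.MathematicalPhysics.QuantumFieldTheory.Balaban1983to89.B4Thm110BoxCut
open Literature.MathematicalPhysics.QuantumFieldTheory.Balaban1983to89.B4Thm110BoxUniform (regular_shift)
open Literature.MathematicalPhysics.QuantumFieldTheory.Balaban1983to89.B4Thm19BoxHolderCut (thm19_holder_boxCut)
open Literature.MathematicalPhysics.QuantumFieldTheory.Balaban1983to89.B4Thm110BoxNoCollar (subField_compField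
  thm110_deriv_box_noCollar)
open Literature.MathematicalPhysics.QuantumFieldTheory.Balaban1983to89.B4Lemma22BoxNoCollar (lemma22_sup_noCollar
  eq220_noCollar)
open Literature.MathematicalPhysics.QuantumFieldTheory.Balaban1983to89.B4Lemma22HolderNoCollar (lemma22_holder_noCollar)
open scoped Matrix

noncomputable section

variable {d : ℕ}
variable {ι : Type} [Fintype ι] [DecidableEq ι]

/-- the component bond function is antisymmetric. [cite: Balaban1983RegularityDecay, p. 576 «A_b̄ = −A_b», dictionary] -/
private theorem compField_antisymm (Ac : (Fin (d + 1) → ℤ) → Fin (d + 1) → ℝ) (x y : Fin (d + 1) → ℤ) :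
    compField Ac y x = -compField Ac x y := by
  unfold compField
  ring

/-- **THEOREM (1.9) OF [B4] ON A BOX, HÖLDER MEMBER, CLOSE PAIRS — FOR EVERY (1.7)-REGULAR FIELD, NO COLLAR, WITH
«e SUFFICIENTLY SMALL» UNIFORM IN `Ω`, THE CONSTANT UNIFORM IN `η`, `K` CHOSEN BEFORE `α`** (pp.573–579; the print's
cut cubes with «Ã_j = A» on every cube): there is `K` (`16 ≤ K`, `4 ∣ K`) such that for `0 ≤ α < 1` there is `c₁ > 0`
such that for all `c ≥ 0`, `β > 0` there is `e₁ > 0` with — for every `k ≥ 1`, `(a,m²) ∈ [a₋,a₊]×[0,m²₊]`, EVERY box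
`Ω = Π[0, nMb_μ)` (`K ∣ Mb_μ`, `1 ≤ Mb_μ`), EVERY component field `A` with `|A_ν(x+e_μ) − A_ν(x)| ≤ c·e^{β−1}η` on `Ω`
(no condition at `∂Ω`), `0 < e ≤ e₁`, direction `μ`, fine sites `x ≠ x′` with `x+e_μ, x′+e_μ ∈ Ω`,
`32|x′−x|_∞ ≤ nK`, a nearest-neighbour chain `Γ` from `x` to `x′` of length `≤ (d+1)|x′−x|_∞` inside the
`|x′−x|_∞`-ball about `x`, every `P` at unit-lattice sup-distance `≥ D` from `x`, every `f` supported in `P` with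
`|f| ≤ φ` — `(n/|x′−x|_∞)^α·|U(A(Γ))(D^η_{A,μ}G_k(Ω,A)f)(x′) − (D^η_{A,μ}G_k(Ω,A)f)(x)|_i ≤ c₁·e^{−D/K}·φ`.
[cite: Balaban1983RegularityDecay, Theorem (1.9) p.573; pp.575–579] -/
theorem thm19_holder_box_noCollar (F : OrthFlow ι) {ℓ₁ : ℝ} (hℓ₁ : 0 ≤ ℓ₁)
    (hLip : ∀ t (v : ι → ℝ), ((F.U t - 1) *ᵥ v) ⬝ᵥ ((F.U t - 1) *ᵥ v) ≤ (ℓ₁ * t) ^ 2 * (v ⬝ᵥ v))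
    (d ℓ : ℕ) (hd : 1 ≤ d) (hℓ : 1 ≤ ℓ) (amin aplus m2plus : ℝ) (ha : 0 < amin) :
    ∃ K : ℕ, 16 ≤ K ∧ 4 ∣ K ∧ ∀ (α : ℝ), 0 ≤ α → α < 1 → ∃ c₁ : ℝ, 0 < c₁ ∧ ∀ (creg β : ℝ), 0 ≤ creg → 0 < β →
      ∃ e₁ : ℝ, 0 < e₁ ∧ ∀ (k : ℕ), 1 ≤ k → ∀ (hn : 1 ≤ (ℓ + 1) ^ k) (a m2 : ℝ),
      amin ≤ a → a ≤ aplus → 0 ≤ m2 → m2 ≤ m2plus →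
      ∀ (Mb : Fin (d + 1) → ℕ), (∀ i, 1 ≤ Mb i) → (∀ μ, K ∣ Mb μ) →
      ∀ (Ac : (Fin (d + 1) → ℤ) → Fin (d + 1) → ℝ) (e : ℝ), 0 < e → e ≤ e₁ →
        (∀ x ∈ Box d ℓ k Mb, ∀ μ ν : Fin (d + 1),
          |Ac (x + e1 μ) ν - Ac x ν| ≤ creg * e ^ (β - 1) / ((ℓ + 1) ^ k : ℕ)) →
      ∀ (μ : Fin (d + 1)) (x x' : ↥(Box d ℓ k Mb)), x.1 + e1 μ ∈ Box d ℓ k Mb → x'.1 + e1 μ ∈ Box d ℓ k Mb →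
        x'.1 ≠ x.1 → 32 * supNorm (x'.1 - x.1) ≤ (((ℓ + 1) ^ k : ℕ) : ℝ) * K →
      ∀ (l : List ↥(Box d ℓ k Mb)), IsNNChain x l → pathEnd x l = x' →
        (l.length : ℝ) ≤ ((d : ℝ) + 1) * supNorm (x'.1 - x.1) →
        (∀ z ∈ l, supNorm (z.1 - x.1) ≤ supNorm (x'.1 - x.1)) →
      ∀ (P : ↥(Box d ℓ k Mb) → Prop) [DecidablePred P] (D : ℝ),
        (∀ x'', P x'' → ∃ ν, D ≤ |posR ℓ k Mb x ν - posR ℓ k Mb x'' ν|) →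
      ∀ (f : ↥(Box d ℓ k Mb) × ι → ℝ), (∀ p, ¬ P p.1 → f p = 0) → ∀ (φ : ℝ), 0 ≤ φ → (∀ p, |f p| ≤ φ) →
      ∀ i : ι,
        ((((ℓ + 1) ^ k : ℕ) : ℝ) / supNorm (x'.1 - x.1)) ^ α *
          |(transport (fieldLink F (e / ((ℓ + 1) ^ k : ℕ)) (fun u v : ↥(Box d ℓ k Mb) => compField Ac u.1 v.1)) x l
              *ᵥ fld (derivA d F (e / ((ℓ + 1) ^ k : ℕ)) ℓ k Mb (fun u v : ↥(Box d ℓ k Mb) => compField Ac u.1 v.1) μ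
                    *ᵥ (greenA d F (e / ((ℓ + 1) ^ k : ℕ)) ℓ k a m2 Mb (baseEmb hn Mb) (stairContour hn Mb)
                        (fun u v : ↥(Box d ℓ k Mb) => compField Ac u.1 v.1) *ᵥ f)) x'
            - fld (derivA d F (e / ((ℓ + 1) ^ k : ℕ)) ℓ k Mb (fun u v : ↥(Box d ℓ k Mb) => compField Ac u.1 v.1) μ
                    *ᵥ (greenA d F (e / ((ℓ + 1) ^ k : ℕ)) ℓ k a m2 Mb (baseEmb hn Mb) (stairContour hn Mb)
                        (fun u v : ↥(Box d ℓ k Mb) => compField Ac u.1 v.1) *ᵥ f)) x) i|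
          ≤ c₁ * Real.exp (-(D / K)) * φ := by
  obtain ⟨C₁, hC₁, h₁⟩ := lemma22_sup_noCollar F hℓ₁ hLip d ℓ hℓ amin aplus m2plus ha
  obtain ⟨C₂, hC₂, h₂⟩ := eq220_noCollar F hℓ₁ hLip d ℓ hℓ amin aplus m2plus ha
  set X : ℝ := (3 : ℝ) ^ (d + 1) * Real.sqrt (Fintype.card ι) * C₂ * Real.exp 1 with hX
  have hX0 : 0 ≤ X := by positivity
  set K : ℕ := 16 * (⌈X⌉₊ + 1) with hK
  have hK16 : 16 ≤ K := by omega
  have h4 : 4 ∣ K := ⟨4 * (⌈X⌉₊ + 1), by omega⟩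
  have hK1 : 1 ≤ K := by omega
  have hKr : (0 : ℝ) < K := by exact_mod_cast hK1
  have hKX : X ≤ K := by
    refine (Nat.le_ceil X).trans ?_
    rw [hK]
    push_cast
    linarith [(Nat.cast_nonneg ⌈X⌉₊ : (0 : ℝ) ≤ ⌈X⌉₊)]
  refine ⟨K, hK16, h4, fun α hα0 hα1 => ?_⟩
  obtain ⟨C₃, hC₃, h₃⟩ := lemma22_holder_noCollar F hℓ₁ hLip d ℓ hℓ amin aplus m2plus ha α hα0 hα1
  set cK : ℝ := C₂ / K with hcK_def
  have hcK : 0 ≤ cK := div_nonneg hC₂.le hKr.le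
  have h3 : (3 : ℝ) ^ (d + 1) * (Real.sqrt (Fintype.card ι) * cK) ≤ Real.exp (-1) := by
    have hexp : Real.exp 1 * Real.exp (-1) = 1 := by rw [← Real.exp_add]; norm_num
    have e : (3 : ℝ) ^ (d + 1) * (Real.sqrt (Fintype.card ι) * cK) = X / K * Real.exp (-1) := by
      rw [hcK_def, hX]
      calc (3 : ℝ) ^ (d + 1) * (Real.sqrt (Fintype.card ι) * (C₂ / K))
          = (3 : ℝ) ^ (d + 1) * Real.sqrt (Fintype.card ι) * C₂ / K * (Real.exp 1 * Real.exp (-1)) := by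
            rw [hexp]; ring
        _ = (3 : ℝ) ^ (d + 1) * Real.sqrt (Fintype.card ι) * C₂ * Real.exp 1 / K * Real.exp (-1) := by ring
    rw [e]
    have : X / K ≤ 1 := div_le_one_of_le₀ hKX (Nat.cast_nonneg K)
    calc X / K * Real.exp (-1) ≤ 1 * Real.exp (-1) := mul_le_mul_of_nonneg_right this (Real.exp_pos _).le
      _ = Real.exp (-1) := one_mul _
  have hD1 := D1_nonneg contDiff_hprof hasCompactSupport_hprof
  have hD2 := D2_nonneg contDiff_hprof hasCompactSupport_hprof
  set c₁ : ℝ := 2 ^ (d + 4) * Real.exp (5 / 2)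
    * (Real.sqrt (Fintype.card ι) * (C₃ + ((d : ℝ) + 1) * D1 hprof * C₁
        + ((d : ℝ) + 3) * (((d : ℝ) + 1) * (D1 hprof + D2 hprof)) * C₁
        + ((d : ℝ) + 1) * (D1 hprof ^ 2 + D2 hprof) * C₁)) + 1 with hc₁
  refine ⟨c₁, by positivity, fun creg β hcreg hβ => ?_⟩
  -- the thresholds at the side bound `2K` of the cut cubes — uniform in `Ω`
  obtain ⟨e₁, he₁, h₁'⟩ := h₁ creg β hcreg hβ (2 * K)
  obtain ⟨e₂, he₂, h₂'⟩ := h₂ creg β hcreg hβ (2 * K) K hK1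
  obtain ⟨e₃, he₃, h₃'⟩ := h₃ creg β hcreg hβ (2 * K)
  refine ⟨min (min e₁ e₂) e₃, lt_min (lt_min he₁ he₂) he₃, ?_⟩
  intro k hk hn a m2 ea1 ea2 em1 em2 Mb hM hKM Ac e he hle h17 μ x x' hxμ hx'μ hne hclose l hl hlend hlen
    hlnear P _ D hD f hfP φ hφ hf i
  have hle1 : e ≤ e₁ := hle.trans ((min_le_left _ _).trans (min_le_left _ _))
  have hle2 : e ≤ e₂ := hle.trans ((min_le_left _ _).trans (min_le_right _ _))
  have hle3 : e ≤ e₃ := hle.trans (min_le_right _ _)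
  have hn2 : 2 ≤ (ℓ + 1) ^ k := by
    calc 2 ≤ ℓ + 1 := by omega
      _ = (ℓ + 1) ^ 1 := (pow_one _).symm
      _ ≤ (ℓ + 1) ^ k := Nat.pow_le_pow_right (Nat.succ_pos ℓ) hk
  have hnK : 16 ≤ (ℓ + 1) ^ k * K := by nlinarith
  have hnK3 : 3 ≤ (ℓ + 1) ^ k * K := le_trans (by norm_num) hnK
  have ha' : 0 < a := lt_of_lt_of_le ha ea1
  set AcS : (Fin (d + 1) → ℤ) → (Fin (d + 1) → ℤ) → Fin (d + 1) → ℝ :=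
    fun j y => Ac (y + fun i => (((ℓ + 1) ^ k : ℕ) : ℤ) * (cubeLo Mb K j i : ℤ)) with hAcS
  have hregS : ∀ j, ∀ y ∈ Box d ℓ k (cubeMs Mb K j), ∀ μ ν : Fin (d + 1),
      |AcS j (y + e1 μ) ν - AcS j y ν| ≤ creg * e ^ (β - 1) / ((ℓ + 1) ^ k : ℕ) :=
    fun j => regular_shift (Mb := Mb) (K := K) j h17
  have hMs1 : ∀ j ∈ labelsK Mb K, ∀ μ, 1 ≤ cubeMs Mb K j μ := fun j hj μ => one_le_cubeMs hK1 hKM hM hj μ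
  have hMsS : ∀ j ∈ labelsK Mb K, ∀ μ, cubeMs Mb K j μ ≤ 2 * K := fun j hj μ => cubeMs_le hK1 hKM hM hj μ
  have hMsK : ∀ j ∈ labelsK Mb K, ∀ μ, K ∣ cubeMs Mb K j μ := fun j hj μ => dvd_cubeMs hK1 hKM hM hj μ
  have hMs3 : ∀ j ∈ labelsK Mb K, ∀ μ, 3 ≤ (ℓ + 1) ^ k * cubeMs Mb K j μ := fun j hj μ =>
    hnK3.trans (Nat.mul_le_mul_left _ (Nat.le_of_dvd (hMs1 j hj μ) (hMsK j hj μ)))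
  have hsub : ∀ j, subField ℓ k Mb (cubeMs Mb K j) (cubeLo Mb K j) (cube_ho Mb K j)
      (fun u v : ↥(Box d ℓ k Mb) => compField Ac u.1 v.1)
      = fun u v : ↥(Box d ℓ k (cubeMs Mb K j)) => compField (AcS j) u.1 v.1 :=
    fun j => subField_compField j Ac
  -- the per-cube inputs on EVERY cut cube at `Ã_j = A`
  have hG : ∀ j ∈ labelsK Mb K, ∀ Φ : ↥(Box d ℓ k (cubeMs Mb K j)) × ι → ℝ,
      supN (greenA d F (e / ((ℓ + 1) ^ k : ℕ)) ℓ k a m2 (cubeMs Mb K j) (baseEmb hn _) (stairContour hn _)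
          (subField ℓ k Mb (cubeMs Mb K j) (cubeLo Mb K j) (cube_ho Mb K j)
            (fun u v : ↥(Box d ℓ k Mb) => compField Ac u.1 v.1)) *ᵥ Φ) ≤ C₁ * supN Φ := by
    intro j hj Φ
    rw [hsub j]
    exact (h₁' k hk hn a m2 ea1 ea2 em1 em2 (cubeMs Mb K j) (hMs1 j hj) (hMsS j hj) (hMs3 j hj) (AcS j) e he
      hle1 (hregS j) Φ).1
  have hDG : ∀ j ∈ labelsK Mb K, ∀ (ν : Fin (d + 1)) (Φ : ↥(Box d ℓ k (cubeMs Mb K j)) × ι → ℝ),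
      supN (derivA d F (e / ((ℓ + 1) ^ k : ℕ)) ℓ k (cubeMs Mb K j)
          (subField ℓ k Mb (cubeMs Mb K j) (cubeLo Mb K j) (cube_ho Mb K j)
            (fun u v : ↥(Box d ℓ k Mb) => compField Ac u.1 v.1)) ν
        *ᵥ (greenA d F (e / ((ℓ + 1) ^ k : ℕ)) ℓ k a m2 (cubeMs Mb K j) (baseEmb hn _) (stairContour hn _)
          (subField ℓ k Mb (cubeMs Mb K j) (cubeLo Mb K j) (cube_ho Mb K j)
            (fun u v : ↥(Box d ℓ k Mb) => compField Ac u.1 v.1)) *ᵥ Φ)) ≤ C₁ * supN Φ := by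
    intro j hj ν Φ
    rw [hsub j]
    exact (h₁' k hk hn a m2 ea1 ea2 em1 em2 (cubeMs Mb K j) (hMs1 j hj) (hMsS j hj) (hMs3 j hj) (AcS j) e he
      hle1 (hregS j) Φ).2 ν
  have hKG : ∀ j ∈ labelsK Mb K, ∀ Φ : ↥(Box d ℓ k (cubeMs Mb K j)) × ι → ℝ,
      supN (kOp F (e / ((ℓ + 1) ^ k : ℕ)) ((ℓ + 1) ^ k) (B1.aSeq a ((ℓ : ℝ) + 1) k) m2 (cubeMs Mb K j)
            (baseEmb hn _) (stairContour hn _)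
            (subField ℓ k Mb (cubeMs Mb K j) (cubeLo Mb K j) (cube_ho Mb K j)
              (fun u v : ↥(Box d ℓ k Mb) => compField Ac u.1 v.1))
            (hBox ((ℓ + 1) ^ k) K (cubeMs Mb K j) (jloc j))
          *ᵥ (greenA d F (e / ((ℓ + 1) ^ k : ℕ)) ℓ k a m2 (cubeMs Mb K j) (baseEmb hn _) (stairContour hn _)
              (subField ℓ k Mb (cubeMs Mb K j) (cubeLo Mb K j) (cube_ho Mb K j)
                (fun u v : ↥(Box d ℓ k Mb) => compField Ac u.1 v.1))
            *ᵥ (mulH (ι := ι) (hBox ((ℓ + 1) ^ k) K (cubeMs Mb K j) (jloc j)) *ᵥ Φ))) ≤ cK * supN Φ := by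
    intro j hj Φ
    rw [hsub j]
    exact h₂' k hk hn hnK3 a m2 ea1 ea2 em1 em2 (cubeMs Mb K j) (hMs1 j hj) (hMsS j hj) (hMsK j hj) (jloc j)
      (AcS j) e he hle2 (hregS j) Φ
  have hHG : ∀ j ∈ labelsK Mb K, ∀ (b b' : ↥(Box d ℓ k (cubeMs Mb K j)))
      (hbμ : b.1 + e1 μ ∈ Box d ℓ k (cubeMs Mb K j)) (hb'μ : b'.1 + e1 μ ∈ Box d ℓ k (cubeMs Mb K j)),
      b'.1 ≠ b.1 → ∀ (lb : List ↥(Box d ℓ k (cubeMs Mb K j))), IsNNChain b lb → pathEnd b lb = b' →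
      (lb.length : ℝ) ≤ ((d : ℝ) + 1) * supNorm (b'.1 - b.1) →
      ∀ Φ : ↥(Box d ℓ k (cubeMs Mb K j)) × ι → ℝ,
      ((((ℓ + 1) ^ k : ℕ) : ℝ) / supNorm (b'.1 - b.1)) ^ α *
        siteNorm (transport (fieldLink F (e / ((ℓ + 1) ^ k : ℕ))
              (subField ℓ k Mb (cubeMs Mb K j) (cubeLo Mb K j) (cube_ho Mb K j)
                (fun u v : ↥(Box d ℓ k Mb) => compField Ac u.1 v.1))) b lb
            *ᵥ fld (derivA d F (e / ((ℓ + 1) ^ k : ℕ)) ℓ k (cubeMs Mb K j)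
                    (subField ℓ k Mb (cubeMs Mb K j) (cubeLo Mb K j) (cube_ho Mb K j)
                      (fun u v : ↥(Box d ℓ k Mb) => compField Ac u.1 v.1)) μ
                  *ᵥ (greenA d F (e / ((ℓ + 1) ^ k : ℕ)) ℓ k a m2 (cubeMs Mb K j) (baseEmb hn _) (stairContour hn _)
                      (subField ℓ k Mb (cubeMs Mb K j) (cubeLo Mb K j) (cube_ho Mb K j)
                        (fun u v : ↥(Box d ℓ k Mb) => compField Ac u.1 v.1)) *ᵥ Φ)) b'
          - fld (derivA d F (e / ((ℓ + 1) ^ k : ℕ)) ℓ k (cubeMs Mb K j)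
                    (subField ℓ k Mb (cubeMs Mb K j) (cubeLo Mb K j) (cube_ho Mb K j)
                      (fun u v : ↥(Box d ℓ k Mb) => compField Ac u.1 v.1)) μ
                  *ᵥ (greenA d F (e / ((ℓ + 1) ^ k : ℕ)) ℓ k a m2 (cubeMs Mb K j) (baseEmb hn _) (stairContour hn _)
                      (subField ℓ k Mb (cubeMs Mb K j) (cubeLo Mb K j) (cube_ho Mb K j)
                        (fun u v : ↥(Box d ℓ k Mb) => compField Ac u.1 v.1)) *ᵥ Φ)) b)
        ≤ C₃ * supN Φ := by
    intro j hj b b' hbμ hb'μ hne' lb hlb hlbend hlblen Φ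
    rw [hsub j]
    exact h₃' k hk hn a m2 ea1 ea2 em1 em2 (cubeMs Mb K j) (hMs1 j hj) (hMsS j hj) (hMs3 j hj) (AcS j) e he
      hle3 (hregS j) μ b ⟨b.1 + e1 μ, hbμ⟩ b' ⟨b'.1 + e1 μ, hb'μ⟩ rfl rfl hne' lb hlb hlbend hlblen Φ
  have main := thm19_holder_boxCut F (e / ((ℓ + 1) ^ k : ℕ)) hℓ hk hn hd Mb hM hK16 h4 hKM ha' em1
    (fun u v : ↥(Box d ℓ k Mb) => compField Ac u.1 v.1) (fun _ u v => compField Ac u.1 v.1)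
    (fun _ u v => compField_antisymm Ac u.1 v.1) (fun _ _ _ _ _ => rfl) hC₁.le hC₁.le hC₃.le hcK hG hDG hKG h3
    μ x x' hxμ hx'μ hne hclose l hl hlend hlen hlnear hα0 hα1.le hHG P hD f hfP hφ hf i
  refine main.trans (mul_le_mul_of_nonneg_right (mul_le_mul_of_nonneg_right ?_ (Real.exp_pos _).le) hφ)
  rw [hc₁]
  linarith

/-- **THEOREM (1.9) OF [B4] ON A BOX, HÖLDER MEMBER, ALL PAIRS — FOR EVERY (1.7)-REGULAR FIELD, NO COLLAR, «e
SUFFICIENTLY SMALL» UNIFORM IN `Ω`, `K` CHOSEN BEFORE `α`**: `∃ K` (`16 ≤ K`, `4 ∣ K`) `∀ α ∈ [0,1)` `∃ c₁ > 0`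
`∀ (c, β)` `∃ e₁ > 0` with — for every `k ≥ 1`, `(a,m²)` in the window, EVERY box `Ω = Π[0, nMb_μ)` (`K ∣ Mb_μ`,
`1 ≤ Mb_μ`), EVERY component field `A` (1.7)-regular on `Ω` (no condition at `∂Ω`), `0 < e ≤ e₁`, direction `μ`,
fine sites `x ≠ x′` with `x+e_μ, x′+e_μ ∈ Ω`, ANY nearest-neighbour chain `Γ` from `x` to `x′` with
`|Γ| ≤ (d+1)|x′−x|_∞` inside the `|x′−x|_∞`-ball about `x`, set `P` at unit-lattice sup-distance `≥ D ≥ 0` from BOTH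
`x` and `x′`, source `f` supported in `P` with `|f| ≤ φ` —
`(n/|x′−x|_∞)^α·|U(A(Γ))(D^η_{A,μ}G_k(Ω,A)f)(x′) − (D^η_{A,μ}G_k(Ω,A)f)(x)|_i ≤ c₁·e^{−D/K}·φ` (close pairs:
`thm19_holder_box_noCollar`; far pairs, p. 578: the derivative member `thm110_deriv_box_noCollar` at `x` and `x′`
and `(n/r)^α ≤ 2`). [cite: Balaban1983RegularityDecay, Theorem (1.9) p.573; (1.10) p.573; p.578; pp.575–579] -/
theorem thm19_holder_box_noCollar_all (F : OrthFlow ι) {ℓ₁ : ℝ} (hℓ₁ : 0 ≤ ℓ₁)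
    (hLip : ∀ t (v : ι → ℝ), ((F.U t - 1) *ᵥ v) ⬝ᵥ ((F.U t - 1) *ᵥ v) ≤ (ℓ₁ * t) ^ 2 * (v ⬝ᵥ v))
    (d ℓ : ℕ) (hd : 1 ≤ d) (hℓ : 1 ≤ ℓ) (amin aplus m2plus : ℝ) (ha : 0 < amin) :
    ∃ K : ℕ, 16 ≤ K ∧ 4 ∣ K ∧ ∀ (α : ℝ), 0 ≤ α → α < 1 → ∃ c₁ : ℝ, 0 < c₁ ∧ ∀ (creg β : ℝ), 0 ≤ creg → 0 < β →
      ∃ e₁ : ℝ, 0 < e₁ ∧ ∀ (k : ℕ), 1 ≤ k → ∀ (hn : 1 ≤ (ℓ + 1) ^ k) (a m2 : ℝ),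
      amin ≤ a → a ≤ aplus → 0 ≤ m2 → m2 ≤ m2plus →
      ∀ (Mb : Fin (d + 1) → ℕ), (∀ i, 1 ≤ Mb i) → (∀ μ, K ∣ Mb μ) →
      ∀ (Ac : (Fin (d + 1) → ℤ) → Fin (d + 1) → ℝ) (e : ℝ), 0 < e → e ≤ e₁ →
        (∀ x ∈ Box d ℓ k Mb, ∀ μ ν : Fin (d + 1),
          |Ac (x + e1 μ) ν - Ac x ν| ≤ creg * e ^ (β - 1) / ((ℓ + 1) ^ k : ℕ)) →
      ∀ (μ : Fin (d + 1)) (x x' : ↥(Box d ℓ k Mb)), x.1 + e1 μ ∈ Box d ℓ k Mb → x'.1 + e1 μ ∈ Box d ℓ k Mb →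
        x'.1 ≠ x.1 →
      ∀ (l : List ↥(Box d ℓ k Mb)), IsNNChain x l → pathEnd x l = x' →
        (l.length : ℝ) ≤ ((d : ℝ) + 1) * supNorm (x'.1 - x.1) →
        (∀ z ∈ l, supNorm (z.1 - x.1) ≤ supNorm (x'.1 - x.1)) →
      ∀ (P : ↥(Box d ℓ k Mb) → Prop) [DecidablePred P] (D : ℝ), 0 ≤ D →
        (∀ x'', P x'' → ∃ ν, D ≤ |posR ℓ k Mb x ν - posR ℓ k Mb x'' ν|) →
        (∀ x'', P x'' → ∃ ν, D ≤ |posR ℓ k Mb x' ν - posR ℓ k Mb x'' ν|) →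
      ∀ (f : ↥(Box d ℓ k Mb) × ι → ℝ), (∀ p, ¬ P p.1 → f p = 0) → ∀ (φ : ℝ), 0 ≤ φ → (∀ p, |f p| ≤ φ) →
      ∀ i : ι,
        ((((ℓ + 1) ^ k : ℕ) : ℝ) / supNorm (x'.1 - x.1)) ^ α *
          |(transport (fieldLink F (e / ((ℓ + 1) ^ k : ℕ)) (fun u v : ↥(Box d ℓ k Mb) => compField Ac u.1 v.1)) x l
              *ᵥ fld (derivA d F (e / ((ℓ + 1) ^ k : ℕ)) ℓ k Mb (fun u v : ↥(Box d ℓ k Mb) => compField Ac u.1 v.1) μ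
                    *ᵥ (greenA d F (e / ((ℓ + 1) ^ k : ℕ)) ℓ k a m2 Mb (baseEmb hn Mb) (stairContour hn Mb)
                        (fun u v : ↥(Box d ℓ k Mb) => compField Ac u.1 v.1) *ᵥ f)) x'
            - fld (derivA d F (e / ((ℓ + 1) ^ k : ℕ)) ℓ k Mb (fun u v : ↥(Box d ℓ k Mb) => compField Ac u.1 v.1) μ
                    *ᵥ (greenA d F (e / ((ℓ + 1) ^ k : ℕ)) ℓ k a m2 Mb (baseEmb hn Mb) (stairContour hn Mb)
                        (fun u v : ↥(Box d ℓ k Mb) => compField Ac u.1 v.1) *ᵥ f)) x) i|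
          ≤ c₁ * Real.exp (-(D / K)) * φ := by
  obtain ⟨K₁, hK₁, h4₁, HU⟩ := thm19_holder_box_noCollar F hℓ₁ hLip d ℓ hd hℓ amin aplus m2plus ha
  obtain ⟨K₂, hK₂, -, c₂, hc₂, H₂⟩ := thm110_deriv_box_noCollar F hℓ₁ hLip d ℓ hd hℓ amin aplus m2plus ha
  set K : ℕ := K₁ * K₂ with hK
  have hK₁K : K₁ ≤ K := by rw [hK]; nlinarith
  have hK₂K : K₂ ≤ K := by rw [hK]; nlinarith
  have hK16 : 16 ≤ K := hK₁.trans hK₁K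
  have h4 : 4 ∣ K := dvd_mul_of_dvd_left h4₁ K₂
  have hK₁r : (0 : ℝ) < K₁ := by exact_mod_cast lt_of_lt_of_le (by norm_num) hK₁
  have hK₂r : (0 : ℝ) < K₂ := by exact_mod_cast lt_of_lt_of_le (by norm_num) hK₂
  have hKr : (0 : ℝ) < K := by exact_mod_cast lt_of_lt_of_le (by norm_num) hK16
  refine ⟨K, hK16, h4, fun α hα0 hα1 => ?_⟩
  obtain ⟨c₁, hc₁, H₁⟩ := HU α hα0 hα1
  set c : ℝ := max c₁ (2 * (((Fintype.card ι : ℝ) + 1) * c₂)) with hc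
  refine ⟨c, lt_of_lt_of_le hc₁ (le_max_left _ _), fun creg β hcreg hβ => ?_⟩
  obtain ⟨e₁, he₁, H₁'⟩ := H₁ creg β hcreg hβ
  obtain ⟨e₂, he₂, H₂'⟩ := H₂ creg β hcreg hβ
  refine ⟨min e₁ e₂, lt_min he₁ he₂, ?_⟩
  intro k hk hn a m2 ea1 ea2 em1 em2 Mb hM hKM Ac e he hle h17 μ x x' hxμ hx'μ hne l hl hlend hlen hlnear P _
    D hD0 hD hD' f hfP φ hφ hf i
  have hnr : (0 : ℝ) < (((ℓ + 1) ^ k : ℕ) : ℝ) := by exact_mod_cast hn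
  have hKM₁ : ∀ ν, K₁ ∣ Mb ν := fun ν => (Dvd.intro K₂ rfl).trans (hKM ν)
  have hKM₂ : ∀ ν, K₂ ∣ Mb ν := fun ν => (Dvd.intro_left K₁ rfl).trans (hKM ν)
  -- `e^{−D/Kᵢ} ≤ e^{−D/K}`
  have hexpK : ∀ K' : ℕ, (0 : ℝ) < K' → K' ≤ K → Real.exp (-(D / K')) ≤ Real.exp (-(D / K)) := by
    intro K' hK'0 hK'
    refine Real.exp_le_exp.2 (neg_le_neg (div_le_div_of_nonneg_left hD0 hK'0 (by exact_mod_cast hK')))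
  by_cases hclose : 32 * supNorm (x'.1 - x.1) ≤ (((ℓ + 1) ^ k : ℕ) : ℝ) * K₁
  · -- close pairs: the walk expansion
    have hb := H₁' k hk hn a m2 ea1 ea2 em1 em2 Mb hM hKM₁ Ac e he (hle.trans (min_le_left _ _)) h17
      μ x x' hxμ hx'μ hne hclose l hl hlend hlen hlnear P D hD f hfP φ hφ hf i
    exact hb.trans (mul_le_mul_of_nonneg_right (mul_le_mul (le_max_left _ _) (hexpK K₁ hK₁r hK₁K)
      (Real.exp_pos _).le (hc₁.le.trans (le_max_left _ _))) hφ)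
  · -- far pairs: Hölder weight `≤ 2`, derivative member at `x` and at `x′`
    set r : ℝ := supNorm (x'.1 - x.1) with hr
    have hr0 : 0 < r := lt_of_lt_of_le zero_lt_one (one_le_supNorm_of_ne hne)
    have hw2 : ((((ℓ + 1) ^ k : ℕ) : ℝ) / r) ^ α ≤ 2 := by
      refine (rpow_le_max_one (div_nonneg hnr.le hr0.le) hα0 hα1.le).trans (max_le (by norm_num) ?_)
      rw [div_le_iff₀ hr0]
      have hK₁16 : (16 : ℝ) ≤ K₁ := by exact_mod_cast hK₁
      push Not at hclose
      nlinarith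
    have hx1 := H₂' k hk hn a m2 ea1 ea2 em1 em2 Mb hM hKM₂ Ac e he (hle.trans (min_le_right _ _)) h17
      μ x hxμ P D hD f hfP φ hφ hf
    have hx2 := H₂' k hk hn a m2 ea1 ea2 em1 em2 Mb hM hKM₂ Ac e he (hle.trans (min_le_right _ _)) h17
      μ x' hx'μ P D hD' f hfP φ hφ hf
    set Ψ := derivA d F (e / ((ℓ + 1) ^ k : ℕ)) ℓ k Mb (fun u v : ↥(Box d ℓ k Mb) => compField Ac u.1 v.1) μ
      *ᵥ (greenA d F (e / ((ℓ + 1) ^ k : ℕ)) ℓ k a m2 Mb (baseEmb hn Mb) (stairContour hn Mb)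
          (fun u v : ↥(Box d ℓ k Mb) => compField Ac u.1 v.1) *ᵥ f) with hΨ
    have hb0 : 0 ≤ c₂ * Real.exp (-(D / K₂)) * φ := by positivity
    have hU : |(transport (fieldLink F (e / ((ℓ + 1) ^ k : ℕ)) (fun u v : ↥(Box d ℓ k Mb) => compField Ac u.1 v.1))
        x l *ᵥ fld Ψ x') i| ≤ (Fintype.card ι : ℝ) * (c₂ * Real.exp (-(D / K₂)) * φ) := by
      rw [transport_fieldLink]
      exact abs_U_mulVec_apply_le F _ _ hb0 (fun k' => hx2 k') i
    have hV : |fld Ψ x i| ≤ c₂ * Real.exp (-(D / K₂)) * φ := hx1 i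
    have hdiff : |(transport (fieldLink F (e / ((ℓ + 1) ^ k : ℕ))
          (fun u v : ↥(Box d ℓ k Mb) => compField Ac u.1 v.1)) x l *ᵥ fld Ψ x' - fld Ψ x) i|
        ≤ ((Fintype.card ι : ℝ) + 1) * (c₂ * Real.exp (-(D / K₂)) * φ) := by
      rw [Pi.sub_apply]
      refine (abs_sub _ _).trans ?_
      linarith
    have hw0 : 0 ≤ ((((ℓ + 1) ^ k : ℕ) : ℝ) / r) ^ α := Real.rpow_nonneg (div_nonneg hnr.le hr0.le) α
    calc ((((ℓ + 1) ^ k : ℕ) : ℝ) / r) ^ α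
          * |(transport (fieldLink F (e / ((ℓ + 1) ^ k : ℕ)) (fun u v : ↥(Box d ℓ k Mb) => compField Ac u.1 v.1))
              x l *ᵥ fld Ψ x' - fld Ψ x) i|
        ≤ 2 * (((Fintype.card ι : ℝ) + 1) * (c₂ * Real.exp (-(D / K₂)) * φ)) :=
          mul_le_mul hw2 hdiff (abs_nonneg _) zero_le_two
      _ = 2 * (((Fintype.card ι : ℝ) + 1) * c₂) * Real.exp (-(D / K₂)) * φ := by ring
      _ ≤ c * Real.exp (-(D / K)) * φ :=
          mul_le_mul_of_nonneg_right (mul_le_mul (le_max_right _ _) (hexpK K₂ hK₂r hK₂K) (Real.exp_pos _).le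
            (hc₁.le.trans (le_max_left _ _))) hφ

end

end Literature.MathematicalPhysics.QuantumFieldTheory.Balaban1983to89.B4Thm19BoxNoCollar
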